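import Summits.QuantumFields.YangMills.Theorems.BalabanUVNodesN11HistoryPinnedResidualDefs

/-!
# DAG node N11 — DEFINITIONS: THE RE-PINNED v1.7 PARAMETER `rePinH θ` (its history-indexed residual 𝐓-weight slot replaced by the certificate family
# `ZhPinOfRecord₁₃`) — the K⁷ antecedent transfers to it, and this seat's binders (P) `hpre`, (V) `hZ`, `hq`, `hqloc` hold at it at EVERY no-expansion history

HEADER — WORK-UNIT METADATA.  Cell `pub-ymgap`, YM-PLAN Track A (HUMAN RULING D-0062), seat `pub-ymgap-dag-n11-d` (g9; R134 fan-out seat N11 [B14], strategy s2),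
route `BalabanUVNodes` rev 25, item K1⁷ `StabilityBAtRecordR13SepCoPH` = stmt-QuantumFields-20542; DEFINITION lane (`--kind definition --supports 20542 --as helper`),
count-neutral.  [III] = [Balaban1988Convergent].  Sequel of `…N11HistoryPinnedResidualDefs` (`ZhPinOfRecord₁₃`, its laws and faces) over node00-def-T's FILE 27∕28T
(`Stage13HParams`, `zhAt`, `rzAt`, `ZhUnity`, `Provisos₁₃CoPH`, `Provisos₁₃SepCoPH`, the door `ofHistoryBlind`).

WHY THIS FILE.  The K⁷ texts quantify over `θ : Stage13HParams` under the antecedent `Provisos₁₃SepCoPH ∧ (ZhUnity ∧ SlotsNondegenerate₁₃) ∧ Admissible`; every row of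
it except `zhLaws`∕`zhLocal`∕`ZhUnity` reads the Stage-13(R) part of `θ` only.  So replacing the history-indexed residual slot of ANY such `θ` by the certificate family
keeps the antecedent (`antecedent_rePinH`, `exists_rePinH_of_exists`: K0⁷'s body ⇒ a re-pinned inhabitant) — and at the re-pinned parameter the four residual-slot binders
of this seat's general-history no-expansion 𝐓-step hold at EVERY no-expansion history by the faces below.  Consumers: `…N11NoExpansionGeneralStepRePinned`.

WHAT THIS FILE DEFINES ∕ PROVES (1 `def`, theorems otherwise; 0 `sorry`, standard axioms; `N`-generic).  `rePinH θ := ⟨θ.toStage13RParams, fun p _ Ω Λ =>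
ZhPinOfRecord₁₃ θ.toStage13Params p Ω Λ, θ.Phih⟩` · `rfl` faces (`_toStage13RParams`, `_toStage13Params`, `_Phih`, `_Zh`, `_Zh_levelFree`, `rePinH_rePinH`, `zhAt_rePinH`,
`rzAt_rePinH`) · ★ `zhUnity_rePinH` (UNCONDITIONAL) · `admissible_rePinH_iff`, `slotsNondegenerate₁₃_rePinH_iff` (`Iff.rfl`) · ★ `provisos₁₃CoPH_rePinH`, ★ `provisos₁₃SepCoPH_rePinH`
(row by row; `zhLaws` from row `zetaUnity`) · ★★ `antecedent_rePinH`, `exists_rePinH_of_exists` · THE PIN FACES ★ `zhAt_rePinH_ζ0_univ_pairCfgAt` (= p544575's (V) `hZ` at every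
`s′` with `Ω_{k+1}(s′) = ∅`, `k < K`), `zhAt_rePinH_ζ0_zero_univ_pairCfg` (p540862's level-one `hZ`), `zhAt_rePinH_quad` (`hq`, `hqloc`), `zhAt_rePinH_eq_init_of_Omega_empty` +
`prefix_agree_rePinH` ((P) `hpre`), `zhAt_rePinH_seqAllLarge` (on the diagonal the residual serving the all-large index IS K0a's `ZrOfRecord₁₃`, as a `TkResidualW`).

HONEST FRAMING.  Definitions + kernel bookkeeping; nothing of Bałaban's asserted; the certificate is NOT H3's value of record (node00-def-K0a∕K0b, [IV]-body read first,
director-ym №186 (1)); `rePinH θ`'s laws 𝐒∕𝐓 (`SLaw₁₃CoPH`∕`TLaw₁₃CoPH`) DIFFER from `θ`'s off the diagonal (they read the slot) — an induction closing K1⁷ at a re-pinned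
witness runs at `rePinH θ` throughout; N11 NOT discharged; K1⁷ NOT closed; counts unmoved (typed 28∕28 · discharged 5∕28).  One finite four-torus programme at fixed
`ε = L^{−K}` — NOT ℝ⁴, NOT OS, NOT a mass gap, NOT Clay.  No `sorry`, `axiom`, `instance`, `notation`.
Sources (SHAPE only): [III] p.245, p.257, (2.1) p.254, (2.18) p.257, (2.20)–(2.22) p.258, (2.24)–(2.28) p.259, (3.16)–(3.22) pp.268–269, (3.23)–(3.25) p.270, p.267,
(1.11) p.248; [Balaban1989LargeFieldI] (0.2)–(0.3) p.176.
-/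

noncomputable section

open MeasureTheory
open scoped BigOperators Matrix.Norms.L2Operator

namespace Summit.QuantumFields.YangMills.Theorems.BalabanUVNodesN11RePinnedParamDefs

open Literature.MathematicalPhysics.QuantumFieldTheory.Balaban1983to89 T4Continuum Node00 Node00.Tk
open B14.Eq218Concrete B15DeterminingSets
open BalabanUVNodesN11HistoryPinnedResidualDefs

variable {F : T4Family} {N : ℕ} [NeZero N]

/-! ## §4  ★★ The re-pinned v1.7 parameter `rePinH θ` and its faces -/

section RePin

variable (θ : Stage13HParams F N)

/-- **★★ THE RE-PINNED v1.7 PARAMETER**: `θ` with its history-indexed residual 𝐓-weight slot REPLACED by the certificate family of §3 (read at the Stage-13 part of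
`θ`; LEVEL-FREE in the step index `n`) — every other field (the Stage-13 part, the run-indexed `Zr`, the smearing functions `Phih`) UNCHANGED.  Every proviso ∕ guard of
the K⁷ texts transfers from `θ` to `rePinH θ` (below), and at `rePinH θ` this seat's binders (P) `hpre`, (V) `hZ`, `hq`, `hqloc` of the general-history no-expansion
𝐓-step hold at EVERY no-expansion history (faces below; consumers in `…N11NoExpansionGeneralStepRePinned`). [cite: Balaban1988Convergent, p.257, (2.20)–(2.22) p.258, (3.16)–(3.20) pp.268–269; Balaban1989LargeFieldI, (0.2)–(0.3) p.176] -/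
def rePinH : Stage13HParams F N :=
  ⟨θ.toStage13RParams, fun p _ Ω Λ => ZhPinOfRecord₁₃ θ.toStage13Params p Ω Λ, θ.Phih⟩

/-- The Stage-13R part is unchanged (`rfl`). [cite: Balaban1988Convergent, (3.16) p.268 (bookkeeping)] -/
@[simp] theorem rePinH_toStage13RParams : (rePinH θ).toStage13RParams = θ.toStage13RParams := rfl

/-- The Stage-13 part is unchanged (`rfl`). [cite: Balaban1988Convergent, (3.16) p.268 (bookkeeping)] -/
theorem rePinH_toStage13Params : (rePinH θ).toStage13Params = θ.toStage13Params := rfl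

/-- The smearing functions are unchanged (`rfl`). [cite: Balaban1988Convergent, (2.24)–(2.25) p.259 (bookkeeping)] -/
@[simp] theorem rePinH_Phih : (rePinH θ).Phih = θ.Phih := rfl

/-- The history-indexed residual slot of the re-pinned parameter IS the certificate family (`rfl`). [cite: Balaban1988Convergent, (3.16)–(3.20) pp.268–269 (bookkeeping)] -/
@[simp] theorem rePinH_Zh (p : B12.RunParams) (n : ℕ) (Ω Λ : ℕ → Set (Site (F.P p.K) 0)) :
    (rePinH θ).Zh p n Ω Λ = ZhPinOfRecord₁₃ θ.toStage13Params p Ω Λ := rfl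

/-- **THE SLOT IS LEVEL-FREE** (it does not read the step index): the hypothesis `hZh` of this seat's `prefix_agree_of_levelFree_of_Omega_empty` (p544575), by `rfl`.
[cite: Balaban1988Convergent, p.257 (bookkeeping)] -/
theorem rePinH_Zh_levelFree (p : B12.RunParams) : ∀ (n n' : ℕ) (Ω Λ : ℕ → Set (Site (F.P p.K) 0)), (rePinH θ).Zh p n Ω Λ = (rePinH θ).Zh p n' Ω Λ :=
  fun _ _ _ _ => rfl

/-- Re-pinning twice is re-pinning once (`rfl`: the certificate reads the Stage-13 part only). [cite: Balaban1988Convergent, (3.16) p.268 (bookkeeping)] -/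
theorem rePinH_rePinH : rePinH (rePinH θ) = rePinH θ := rfl

/-- The residual serving the history `s` at the re-pinned parameter (`rfl`). [cite: Balaban1988Convergent, (3.16)–(3.20) pp.268–269 (bookkeeping)] -/
theorem zhAt_rePinH (p : B12.RunParams) {n : ℕ} (s : SeqOfRecord F θ.ν θ.τ9.M (gOfRecord₁₃ F N θ.toStage13Params p) p.K n) :
    (rePinH θ).zhAt p s = ZhPinOfRecord₁₃ θ.toStage13Params p s.Ω s.Λ := rfl

/-- The §2 residual serving the history `s` is unchanged (`rfl`). [cite: Balaban1988Convergent, (2.24)–(2.28) p.259 (bookkeeping)] -/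
theorem rzAt_rePinH (p : B12.RunParams) {n : ℕ} (s : SeqOfRecord F θ.ν θ.τ9.M (gOfRecord₁₃ F N θ.toStage13Params p) p.K n) :
    (rePinH θ).rzAt p s = θ.rzAt p s := rfl

variable {θ}

/-- **★ PRINT'S PARTITION OF UNITY HOLDS AT THE RE-PINNED PARAMETER** (the guard `ZhUnity` of the K⁷ texts), unconditionally. [cite: Balaban1988Convergent, (3.16)–(3.20) pp.268–269] -/
theorem zhUnity_rePinH : (rePinH θ).ZhUnity F N :=
  fun p _ Ω Λ j ω => finsum_ζ0_ZhPinOfRecord₁₃ (θ := θ.toStage13Params) (p := p) Ω Λ j ω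

/-- Admissibility is read through the Stage-13 part: unchanged (`Iff.rfl`). [cite: Balaban1988Convergent, (2.9) p.256 (bookkeeping)] -/
theorem admissible_rePinH_iff : (rePinH θ).Admissible F N ↔ θ.Admissible F N := Iff.rfl

/-- The slot non-degeneracy guard is read through the Stage-13 part: unchanged (`Iff.rfl`). [cite: Balaban1988Convergent, (2.18) p.257 (bookkeeping)] -/
theorem slotsNondegenerate₁₃_rePinH_iff : (rePinH θ).SlotsNondegenerate₁₃ F N ↔ θ.SlotsNondegenerate₁₃ F N := Iff.rfl

/-- **★ def-T's v1.7 CORE PROVISOS TRANSFER TO THE RE-PINNED PARAMETER**: every row except `zhLaws`∕`zhLocal` reads the Stage-13 part only (verbatim), and the two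
residual rows hold for the certificate family by §3 (`zhLaws` from the row `zetaUnity`). [cite: Balaban1988Convergent, (2.18) p.257, (2.21) p.258, (3.2)–(3.9) pp.265–266, (3.16) p.268, p.267] -/
theorem provisos₁₃CoPH_rePinH (h : θ.Provisos₁₃CoPH F N) : (rePinH θ).Provisos₁₃CoPH F N where
  intPiece := h.intPiece
  measω := h.measω
  measChi := h.measChi
  zetaUnity := h.zetaUnity
  zetaAbs := h.zetaAbs
  rstep := fun p k _ hk => h.rstep p k hk
  rzLaws := h.rzLaws
  zhLaws := fun p _ Ω Λ => laws_ZhPinOfRecord₁₃ (θ := θ.toStage13Params) (p := p) h.zetaUnity Ω Λ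
  zhLocal := fun p _ Ω Λ => localLaws_ZhPinOfRecord₁₃ (θ := θ.toStage13Params) (p := p) Ω Λ

/-- **★ def-T's v1.7 SEPARATED-RANGE PROVISOS (the K⁷ texts' `Provisos₁₃SepCoPH`) TRANSFER TO THE RE-PINNED PARAMETER** (rows `hM`, `hM₁`, `bg` read the
Stage-13R part only). [cite: Balaban1988Convergent, p.245, (2.28) p.259, (3.16) p.268, p.267] -/
theorem provisos₁₃SepCoPH_rePinH (h : θ.Provisos₁₃SepCoPH F N) : (rePinH θ).Provisos₁₃SepCoPH F N where
  intPiece := h.intPiece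
  measω := h.measω
  measChi := h.measChi
  zetaUnity := h.zetaUnity
  zetaAbs := h.zetaAbs
  rstep := fun p k _ hk => h.rstep p k hk
  rzLaws := h.rzLaws
  zhLaws := fun p _ Ω Λ => laws_ZhPinOfRecord₁₃ (θ := θ.toStage13Params) (p := p) h.zetaUnity Ω Λ
  zhLocal := fun p _ Ω Λ => localLaws_ZhPinOfRecord₁₃ (θ := θ.toStage13Params) (p := p) Ω Λ
  hM := h.hM
  hM₁ := h.hM₁
  bg := h.bg

/-- **★★ THE K⁷ ANTECEDENT IS INVARIANT UNDER RE-PINNING**: if `θ` carries def-T's separated-range provisos, the slot non-degeneracy guard and admissibility, so does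
`rePinH θ` — and `rePinH θ` carries print's partition of unity REGARDLESS of `θ`'s.  Hence every inhabitant of K0⁷ `Record13SepCoPHInhabited`'s body yields one
whose residual 𝐓-weight slot is the certificate family. [cite: Balaban1988Convergent, Thm 1 p.262, (3.16)–(3.22) pp.268–269 (bookkeeping)] -/
theorem antecedent_rePinH (h : θ.Provisos₁₃SepCoPH F N) (hnd : θ.SlotsNondegenerate₁₃ F N) (hadm : θ.Admissible F N) :
    (rePinH θ).Provisos₁₃SepCoPH F N ∧ ((rePinH θ).ZhUnity F N ∧ (rePinH θ).SlotsNondegenerate₁₃ F N) ∧ (rePinH θ).Admissible F N :=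
  ⟨provisos₁₃SepCoPH_rePinH h, ⟨zhUnity_rePinH, slotsNondegenerate₁₃_rePinH_iff.mpr hnd⟩, admissible_rePinH_iff.mpr hadm⟩

/-- **… in the shape of K0⁷'s body**: an inhabitant of `∃ θ, Provisos₁₃SepCoPH ∧ (ZhUnity ∧ SlotsNondegenerate₁₃) ∧ Admissible` gives a RE-PINNED inhabitant.
[cite: Balaban1988Convergent, Thm 1 p.262 (bookkeeping)] -/
theorem exists_rePinH_of_exists
    (h : ∃ θ : Stage13HParams F N, θ.Provisos₁₃SepCoPH F N ∧ (θ.ZhUnity F N ∧ θ.SlotsNondegenerate₁₃ F N) ∧ θ.Admissible F N) :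
    ∃ θ : Stage13HParams F N, rePinH θ = θ ∧ θ.Provisos₁₃SepCoPH F N ∧ (θ.ZhUnity F N ∧ θ.SlotsNondegenerate₁₃ F N) ∧ θ.Admissible F N := by
  obtain ⟨θ, hP, ⟨-, hnd⟩, hadm⟩ := h
  exact ⟨rePinH θ, rePinH_rePinH θ, antecedent_rePinH hP hnd hadm⟩

/-! ### The pin faces at the re-pinned parameter: this seat's binders (P), (V), `hq`, `hqloc` at EVERY no-expansion history -/

variable (θ) (p : B12.RunParams)

/-- **(V) `hZ` AT EVERY NO-EXPANSION HISTORY**: at `s′` of length `k+1` with `Ω_{k+1}(s′) = ∅`, `k < K`, the generation-`k` factor `ζ0_k(T)` of the residual serving `s′`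
at g3's two-scale configuration IS `χ_k(Ω_k(init s′))(U₀) · w_k(s′)(U₀, Ū₀)` — LITERALLY the binder of p544575 `clause_succ_CoPH_of_Omega_empty_of_pinChi_of_clause`.
[cite: Balaban1988Convergent, (2.21) p.258, (3.16) p.268, (3.24)–(3.25) p.270] -/
theorem zhAt_rePinH_ζ0_univ_pairCfgAt {k : ℕ} (hk : k < p.K) (s : SeqOfRecord F θ.ν θ.τ9.M (gOfRecord₁₃ F N θ.toStage13Params p) p.K (k + 1))
    (hΩ : s.Ω (k + 1) = ∅) (V' : GaugeField (F.P p.K) (k + 1) (SU N)) (U₀ : GaugeField (F.P p.K) k (SU N)) :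
    ((rePinH θ).zhAt p s).ζ0 k Set.univ (pairCfgAt (V := FluctV N) k V' U₀) =
      chiSeqOfRecord F N θ.ν θ.τ9.M (gOfRecord₁₃ F N θ.toStage13Params p) p.K k s.init U₀ *
        wOfRecord₉ F N θ.toStage9Params p (gOfRecord₁₃ F N θ.toStage13Params p) k s U₀ ((avOfRecord F N p.K k).avg U₀) := by
  rw [zhAt_rePinH, ZhPinOfRecord₁₃_ζ0_univ_of_hist hk (isNoExpHistAt_self (θ := θ.toStage13Params) (p := p) s hΩ), histPinOfRecord₁₃_pairCfgAt]

/-- **(V) AT LEVEL ONE**: at `s′` of length `1` with `Ω₁(s′) = ∅`, `0 < K`, `ζ0_0(T)` at 11a's two-scale configuration IS `w(s′)(U, Ū)` — the binder of p540862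
`hasSect2FormAtZS_clause_one_CoPH_of_provisos`. [cite: Balaban1988Convergent, (1.11) p.248, (2.21) p.258, (3.25) p.270] -/
theorem zhAt_rePinH_ζ0_zero_univ_pairCfg (hK : 0 < p.K) (s : SeqOfRecord F θ.ν θ.τ9.M (gOfRecord₁₃ F N θ.toStage13Params p) p.K 1) (hΩ : s.Ω 1 = ∅)
    (V1 : GaugeField (F.P p.K) 1 (SU N)) (Uf : GaugeField (F.P p.K) 0 (SU N)) :
    ((rePinH θ).zhAt p s).ζ0 0 Set.univ (pairCfg (V := FluctV N) V1 Uf) =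
      wOfRecord₉ F N θ.toStage9Params p (gOfRecord₁₃ F N θ.toStage13Params p) 0 s Uf ((avOfRecord F N p.K 0).avg Uf) := by
  rw [zhAt_rePinH, ZhPinOfRecord₁₃_ζ0_univ_of_hist hK (isNoExpHistAt_self (θ := θ.toStage13Params) (p := p) s hΩ), histPinOfRecord₁₃_pairCfg]

/-- **`hq` ∕ `hqloc`**: the residual serving any history has `quad ≡ 0` (`rfl`). [cite: Balaban1988Convergent, (3.23) p.270 (bookkeeping)] -/
@[simp] theorem zhAt_rePinH_quad {n : ℕ} (s : SeqOfRecord F θ.ν θ.τ9.M (gOfRecord₁₃ F N θ.toStage13Params p) p.K n) (j : ℕ) (Λ' : Set (Site (F.P p.K) 0))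
    (ω : MultiCfg (F.P p.K) (SU N) (FluctV N)) : ((rePinH θ).zhAt p s).quad j Λ' ω = 0 := rfl

/-- **(P) `hpre` AT EVERY NO-EXPANSION STEP**: at `s′` with `Ω_{k+1}(s′) = ∅` the residual serving `s′` IS the residual serving `init s′` (the slot is level-free and
`init s′`, `s′` have the same raw set-sequences). [cite: Balaban1988Convergent, (2.1) p.254, p.257, (2.20)–(2.22) p.258] -/
theorem zhAt_rePinH_eq_init_of_Omega_empty {k : ℕ} (s : SeqOfRecord F θ.ν θ.τ9.M (gOfRecord₁₃ F N θ.toStage13Params p) p.K (k + 1)) (hΩ : s.Ω (k + 1) = ∅) :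
    (rePinH θ).zhAt p s = (rePinH θ).zhAt p s.init := by
  have hΛ : s.Λ (k + 1) = ∅ := Set.subset_eq_empty (s.chain.Λ_subset (k + 1) (Nat.succ_pos k) le_rfl) hΩ
  have hΩf : s.init.Ω = s.Ω := by
    funext j
    rcases Nat.lt_or_ge k j with hj | hj
    · rw [s.init.Ω_off j (fun h => absurd h.2 (not_le.mpr hj))]
      rcases Nat.lt_or_ge (k + 1) j with hj' | hj'
      · exact (s.Ω_off j (fun h => absurd h.2 (not_le.mpr hj'))).symm
      · obtain rfl : j = k + 1 := le_antisymm hj' hj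
        exact hΩ.symm
    · exact seq_init_Ω_of_le s hj
  have hΛf : s.init.Λ = s.Λ := by
    funext j
    rcases Nat.lt_or_ge k j with hj | hj
    · rw [s.init.Λ_off j (fun h => absurd h.2 (not_le.mpr hj))]
      rcases Nat.lt_or_ge (k + 1) j with hj' | hj'
      · exact (s.Λ_off j (fun h => absurd h.2 (not_le.mpr hj'))).symm
      · obtain rfl : j = k + 1 := le_antisymm hj' hj
        exact hΛ.symm
    · exact seq_init_Λ_of_le s hj
  rw [zhAt_rePinH, zhAt_rePinH, hΩf, hΛf]

/-- … hence the prefix agreement of p544575 (every `j`). [cite: Balaban1988Convergent, p.257 (bookkeeping)] -/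
theorem prefix_agree_rePinH {k : ℕ} (s : SeqOfRecord F θ.ν θ.τ9.M (gOfRecord₁₃ F N θ.toStage13Params p) p.K (k + 1)) (hΩ : s.Ω (k + 1) = ∅) :
    ∀ j, j < k → ((rePinH θ).zhAt p s).ζ0 j = ((rePinH θ).zhAt p s.init).ζ0 j ∧ ((rePinH θ).zhAt p s).quad j = ((rePinH θ).zhAt p s.init).quad j :=
  fun _ _ => by rw [zhAt_rePinH_eq_init_of_Omega_empty θ p s hΩ]; exact ⟨rfl, rfl⟩

/-- **ALONG THE ALL-LARGE-FIELD DIAGONAL THE RE-PINNED SLOT IS node00-def-K0a's RESIDUAL OF RECORD** (as a `TkResidualW`): at the all-large index of any length the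
residual serving it at `rePinH θ` IS `ZrOfRecord₁₃ θ.toStage13Params p` — so at the door of the cured witness family the diagonal theorems of this seat and of
dag-n11-e apply to `rePinH` verbatim on the diagonal. [cite: Balaban1988Convergent, (1.11) p.248, p.267, (3.16)–(3.20) pp.268–269 (bookkeeping)] -/
theorem zhAt_rePinH_seqAllLarge (n : ℕ) :
    (rePinH θ).zhAt p (seqAllLargeOfRecord F θ.ν θ.τ9.M (gOfRecord₁₃ F N θ.toStage13Params p) p.K n) = ZrOfRecord₁₃ F N θ.toStage13Params p := by
  rw [zhAt_rePinH]
  show TkResidualW.mk _ _ = TkResidualW.mk _ _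
  congr 1
  funext j Y ω
  exact ZhPinOfRecord₁₃_ζ0_seqAllLarge (θ := θ.toStage13Params) (p := p) n j Y ω

end RePin

end Summit.QuantumFields.YangMills.Theorems.BalabanUVNodesN11RePinnedParamDefs

end
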